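import Mathlib
import Literature.MathematicalPhysics.QuantumLattice.WilsonDiracAP
import Summits.QuantumFields.QCD.Theorems.QuarksAsStableActionUnquenchedChessboardBoundStubChessboard

/-!
# Consistent cell words on the even four-torus and their reflection doubles
(helper for crux stmt-QuantumFields-9734, line `Sketch`, stub `stub_quarkChessboard_of_schwarz`,
auxiliary file 1; registered sub-goal `stub_quarkChessboard_of_schwarzAux1`)

Bookkeeping for the Fröhlich–Israel–Lieb–Simon iteration (FILS 1978, Thm. 4.3) from the background
Schwarz inequality to the quark chessboard.  Cells of `(ℤ/L)⁴` carry letters `α`, read through an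
abstract link reading `rd a ε μ` (the `μ`-link at the corner `ε ∈ (ℤ/2)⁴` of the closed unit
hypercube) and reflected by `r i` (`rd (r i a) ε i = (rd a ε i)⁻¹`, `rd (r i a) ε μ = rd a (ε + eᵢ) μ`
for `μ ≠ i`).  A word is CONSISTENT (`Cons`) when adjacent cells agree on their common face; its
FIELD is `Fld w (x, μ) = rd (w x) 0 μ`.  Consistency is preserved by the full cell reflection
(`cons_reflect`, field = site reflection `Θᵢ` of the field, `fld_reflect`) and by gluing along the
layers `cᵢ < L/2 | cᵢ ≥ L/2` (`cons_glue`); so the symmetrised words of the abstract chessboard are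
consistent (`cons_symP`, `cons_symM`) with fields exactly the DOUBLES `V⁺⁺`, `V⁻⁻` of item
stmt-QuantumFields-10349 in axis `i` (`fld_symP`, `fld_symM`, boundary planes `xᵢ = 0, L/2`
included); plus idempotence and translation covariance.  Pointwise defining hypotheses only; no
definitions.
-/
noncomputable section

open scoped BigOperators Classical Matrix ComplexConjugate
open Finset
open Literature.MathematicalPhysics.QuantumLattice Literature.MathematicalPhysics.QuantumFieldTheory
  Literature.Barriers.CriticalPhenomena

namespace Summit.QuantumFields.QCD.Cruxes.CriticalLineDiamagnetism.ChessboardCellGain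

section ZModVal

variable {L : ℕ} [NeZero L]

/-- An even nonzero natural number is at least `2`. -/
theorem two_le_of_even' (hL : Even L) : 2 ≤ L := by
  obtain ⟨k, hk⟩ := hL; have := NeZero.ne L; omega

/-- `(-1 - c).val = L - 1 - c.val`: the representative of a reflected cell coordinate. -/
theorem val_neg_one_sub (c : ZMod L) : (-1 - c).val = L - 1 - c.val := by
  rw [show (-1 - c : ZMod L) = -c - 1 by ring]; exact NonGibbs.zmod_val_neg_sub_one c

/-- For even `L`, the cell reflection `c ↦ -1 - c` exchanges the two halves. -/
theorem val_refl_lt_half_iff (hL : Even L) (c : ZMod L) :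
    (-1 - c).val < L / 2 ↔ ¬c.val < L / 2 := by
  obtain ⟨k, hk⟩ := hL; rw [val_neg_one_sub]; have := ZMod.val_lt c; omega

/-- **Registered sub-goal of this auxiliary file**: for even `L` the cell reflection `c ↦ -1 - c`
through the cell boundaries `0 | L/2` exchanges the two halves of `ℤ/Lℤ`. -/
theorem stub_quarkChessboard_of_schwarzAux1 :
    ∀ {L : ℕ} [NeZero L], Even L → ∀ c : ZMod L, (-1 - c).val < L / 2 ↔ ¬c.val < L / 2 :=
  fun hL c => val_refl_lt_half_iff hL c

/-- For even `L`, the site plane `xᵢ = L/2` is fixed by `x ↦ -x`. -/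
theorem neg_eq_self_of_val (hL : Even L) {c : ZMod L} (h : c.val = L / 2) : -c = c := by
  have hc : c = ((L / 2 : ℕ) : ZMod L) := by rw [← h, ZMod.natCast_zmod_val]
  rw [hc, neg_eq_iff_add_eq_zero, ← Nat.cast_add, ← two_mul, Nat.two_mul_div_two_of_even hL,
    ZMod.natCast_self]

/-- `2c + 2 = 0` for the last cell of either half (`c.val = L/2 - 1` or `c.val = L - 1`). -/
theorem two_mul_add_two_eq_zero (hL : Even L) {c : ZMod L} (h : c.val = L / 2 - 1 ∨ c.val = L - 1) :
    2 * c + 2 = (0 : ZMod L) := by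
  have h2 := two_le_of_even' hL
  obtain ⟨n, hn, hN⟩ : ∃ n : ℕ, c = (n : ZMod L) ∧ (2 * n + 2 = L ∨ 2 * n + 2 = 2 * L) := by
    obtain ⟨k, hk⟩ := hL
    rcases h with h | h
    · exact ⟨L / 2 - 1, by rw [← h, ZMod.natCast_zmod_val], Or.inl (by omega)⟩
    · exact ⟨L - 1, by rw [← h, ZMod.natCast_zmod_val], Or.inr (by omega)⟩
  rw [hn]
  have e : (2 : ZMod L) * (n : ZMod L) + 2 = ((2 * n + 2 : ℕ) : ZMod L) := by push_cast; ring
  rw [e]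
  rcases hN with hN | hN
  · rw [hN, ZMod.natCast_self]
  · rw [hN, Nat.cast_mul, ZMod.natCast_self, mul_zero]

/-- `-1 - c = c + 1` for the last cell of either half. -/
theorem neg_one_sub_eq_add_one (hL : Even L) {c : ZMod L}
    (h : c.val = L / 2 - 1 ∨ c.val = L - 1) : -1 - c = c + 1 := by
  linear_combination (-1 : ZMod L) * two_mul_add_two_eq_zero hL h

/-- `-1 - (c + 1) = c` for the last cell of either half. -/
theorem neg_one_sub_add_one (hL : Even L) {c : ZMod L}
    (h : c.val = L / 2 - 1 ∨ c.val = L - 1) : -1 - (c + 1) = c := by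
  linear_combination (-1 : ZMod L) * two_mul_add_two_eq_zero hL h

/-- The representative of `c + 1`: either `c` is the last residue and `c + 1 = 0`, or the
representative goes up by one. -/
theorem val_add_one_cases (c : ZMod L) :
    (c.val = L - 1 ∧ (c + 1).val = 0) ∨ (c.val + 1 < L ∧ (c + 1).val = c.val + 1) := by
  have hc := ZMod.val_lt c
  by_cases h : c.val = L - 1
  · refine Or.inl ⟨h, ?_⟩
    have e : c + 1 = ((L - 1 + 1 : ℕ) : ZMod L) := by
      rw [Nat.cast_add, Nat.cast_one, ← h, ZMod.natCast_zmod_val]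
    rw [e, Nat.sub_add_cancel NeZero.one_le, ZMod.natCast_self, ZMod.val_zero]
  · have h1 : (1 : ZMod L).val = 1 := by
      rw [ZMod.val_one_eq_one_mod, Nat.mod_eq_of_lt (by omega)]
    refine Or.inr ⟨by omega, ?_⟩
    rw [ZMod.val_add_of_lt (by rw [h1]; omega), h1]

end ZModVal

section Geometry

variable {L : ℕ}

/-- `(x + eᵢ)ᵢ = xᵢ + 1`. -/
theorem shift_apply_same (x : Site 4 L) (i : Fin 4) : Site.shift x i i = x i + 1 := by
  simp [Site.shift]

/-- `(x + eᵢ)ⱼ = xⱼ` for `j ≠ i`. -/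
theorem shift_apply_of_ne (x : Site 4 L) {i j : Fin 4} (h : j ≠ i) : Site.shift x i j = x j := by
  simp [Site.shift, Pi.single_eq_of_ne h]

/-- `x + eᵢ = x[i ↦ xᵢ + 1]`. -/
theorem shift_eq_update (x : Site 4 L) (i : Fin 4) : Site.shift x i = Function.update x i (x i + 1) := by
  ext j; rcases eq_or_ne j i with rfl | h
  · rw [shift_apply_same, Function.update_self]
  · rw [shift_apply_of_ne x h, Function.update_of_ne h]

/-- `(x + eᵢ)[i ↦ xᵢ] = x`. -/
theorem update_shift_self (x : Site 4 L) (i : Fin 4) : Function.update (Site.shift x i) i (x i) = x := by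
  ext j; rcases eq_or_ne j i with rfl | h
  · rw [Function.update_self]
  · rw [Function.update_of_ne h, shift_apply_of_ne x h]

/-- Reflecting a cell commutes with the transverse shifts: `refl_i (z + e_j) = refl_i z + e_j`. -/
theorem refl_shift_of_ne (z : Site 4 L) {i j : Fin 4} (h : j ≠ i) :
    Function.update (Site.shift z j) i (-1 - Site.shift z j i) =
      Site.shift (Function.update z i (-1 - z i)) j := by
  ext ν; rcases eq_or_ne ν i with rfl | hν
  · rw [Function.update_self, shift_apply_of_ne _ (Ne.symm h), shift_apply_of_ne _ (Ne.symm h),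
      Function.update_self]
  · rw [Function.update_of_ne hν]
    rcases eq_or_ne ν j with rfl | hνj
    · rw [shift_apply_same, shift_apply_same, Function.update_of_ne hν]
    · rw [shift_apply_of_ne _ hνj, shift_apply_of_ne _ hνj, Function.update_of_ne hν]

/-- `refl_i (z + e_i) + e_i = refl_i z`. -/
theorem shift_refl_shift (z : Site 4 L) (i : Fin 4) :
    Site.shift (Function.update (Site.shift z i) i (-1 - Site.shift z i i)) i =
      Function.update z i (-1 - z i) := by
  ext ν; rcases eq_or_ne ν i with rfl | hν
  · rw [shift_apply_same, Function.update_self, Function.update_self, shift_apply_same]; ring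
  · rw [shift_apply_of_ne _ hν, Function.update_of_ne hν, Function.update_of_ne hν,
      shift_apply_of_ne _ hν]

/-- `refl_i x + e_i = x[i ↦ -xᵢ]`. -/
theorem shift_refl (x : Site 4 L) (i : Fin 4) :
    Site.shift (Function.update x i (-1 - x i)) i = Function.update x i (-x i) := by
  ext ν; rcases eq_or_ne ν i with rfl | hν
  · rw [shift_apply_same, Function.update_self, Function.update_self]; ring
  · rw [shift_apply_of_ne _ hν, Function.update_of_ne hν, Function.update_of_ne hν]

/-- `refl_i x = (x + e_i)[i ↦ -(x + e_i)ᵢ]`. -/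
theorem refl_eq_update_shift (x : Site 4 L) (i : Fin 4) :
    Function.update x i (-1 - x i) = Function.update (Site.shift x i) i (-Site.shift x i i) := by
  ext ν; rcases eq_or_ne ν i with rfl | hν
  · rw [Function.update_self, Function.update_self, shift_apply_same]; ring
  · rw [Function.update_of_ne hν, Function.update_of_ne hν, shift_apply_of_ne _ hν]

/-- `eᵢ + eᵢ = 0` in `(ℤ/2)⁴`. -/
theorem single_one_add_single_one (i : Fin 4) :
    (Pi.single i (1 : ZMod 2) : Fin 4 → ZMod 2) + Pi.single i 1 = 0 := by
  rw [← Pi.single_add]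
  exact Pi.single_eq_zero_iff.2 (by decide)

end Geometry

section Words

variable {L : ℕ} [NeZero L] {α G : Type*} [Group G]
  {r : Fin 4 → α → α} {rd : α → (Fin 4 → ZMod 2) → Fin 4 → G}
  (hri : ∀ i a ε, rd (r i a) ε i = (rd a ε i)⁻¹)
  (hrn : ∀ i a ε μ, μ ≠ i → rd (r i a) ε μ = rd a (ε + Pi.single i 1) μ)
  {Cons : (Site 4 L → α) → Prop}
  (hCons : ∀ w, Cons w ↔ ∀ z j μ ε, μ ≠ j → ε j = 0 →
    rd (w z) (ε + Pi.single j 1) μ = rd (w (Site.shift z j)) ε μ)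
  {Fld : (Site 4 L → α) → GaugeConfig 4 L G}
  (hFld : ∀ w e, Fld w e = rd (w e.1) 0 e.2)

omit [NeZero L] in
include hri hrn hCons in
/-- **Consistency is preserved by the full cell reflection** `c ↦ r i (w (c[i ↦ -1 - cᵢ]))`. -/
theorem cons_reflect {w : Site 4 L → α} (hw : Cons w) (i : Fin 4) :
    Cons (fun c => r i (w (Function.update c i (-1 - c i)))) := by
  rw [hCons] at hw ⊢
  intro z j μ ε hμj hεj
  by_cases hμi : μ = i
  · subst hμi
    rw [hri, hri, refl_shift_of_ne z (Ne.symm hμj), hw _ j μ ε hμj hεj]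
  · rw [hrn _ _ _ _ hμi, hrn _ _ _ _ hμi]
    by_cases hji : j = i
    · subst hji
      rw [add_assoc, single_one_add_single_one, add_zero, ← shift_refl_shift z j]
      exact (hw _ j μ ε hμj hεj).symm
    · rw [refl_shift_of_ne z hji, add_right_comm]
      exact hw _ j μ _ hμj (by rw [Pi.add_apply, hεj, Pi.single_eq_of_ne hji, zero_add])

omit [NeZero L] in
include hri hrn hCons hFld in
/-- **The field of the fully reflected word is the site reflection `Θᵢ` of the field**:
`μ = i` links are reversed and inverted, transverse links are read at the reflected site (this
uses consistency across the face shared by `refl_i x` and `refl_i x + eᵢ`). -/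
theorem fld_reflect {w : Site 4 L → α} (hw : Cons w) (i : Fin 4) :
    Fld (fun c => r i (w (Function.update c i (-1 - c i)))) = fun e : Edge 4 L =>
      if e.2 = i then (Fld w (Function.update (Site.shift e.1 i) i (-Site.shift e.1 i i), i))⁻¹
      else Fld w (Function.update e.1 i (-e.1 i), e.2) := by
  rw [hCons] at hw
  funext ⟨x, μ⟩
  simp only [hFld]
  by_cases hμ : μ = i
  · subst hμ
    rw [if_pos rfl, hri, refl_eq_update_shift]
  · rw [if_neg hμ, hrn _ _ _ _ hμ, ← shift_refl x i]
    exact hw _ i μ 0 hμ rfl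

omit [Group G] in
include hCons in
/-- **Gluing two consistent words along the layers `cᵢ < L/2 | cᵢ ≥ L/2`** is consistent as soon
as they agree across the two boundary planes `xᵢ = L/2` and `xᵢ = 0`. -/
theorem cons_glue (hL : Even L) {w₁ w₂ : Site 4 L → α} (hw₁ : Cons w₁) (hw₂ : Cons w₂) (i : Fin 4)
    (hb₁ : ∀ z μ ε, (z i).val = L / 2 - 1 → μ ≠ i → ε i = 0 →
      rd (w₁ z) (ε + Pi.single i 1) μ = rd (w₂ (Site.shift z i)) ε μ)
    (hb₂ : ∀ z μ ε, (z i).val = L - 1 → μ ≠ i → ε i = 0 →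
      rd (w₂ z) (ε + Pi.single i 1) μ = rd (w₁ (Site.shift z i)) ε μ) :
    Cons (fun c => if (c i).val < L / 2 then w₁ c else w₂ c) := by
  rw [hCons] at hw₁ hw₂ ⊢
  intro z j μ ε hμj hεj
  by_cases hji : j = i
  · subst hji
    rw [shift_apply_same]
    have hL0 := NeZero.ne L
    obtain ⟨k, hk⟩ := hL
    rcases val_add_one_cases (z j) with ⟨h1, h2⟩ | ⟨h1, h2⟩
    · rw [h2, if_neg (by omega), if_pos (by omega)]
      exact hb₂ z μ ε h1 hμj hεj
    · rw [h2]
      by_cases hlt : (z j).val + 1 < L / 2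
      · rw [if_pos (by omega), if_pos hlt]
        exact hw₁ z j μ ε hμj hεj
      · by_cases heq : (z j).val + 1 = L / 2
        · rw [if_pos (by omega), if_neg hlt]
          exact hb₁ z μ ε (by omega) hμj hεj
        · rw [if_neg (by omega), if_neg hlt]
          exact hw₂ z j μ ε hμj hεj
  · rw [shift_apply_of_ne z (Ne.symm hji)]
    by_cases h : (z i).val < L / 2
    · rw [if_pos h, if_pos h]
      exact hw₁ z j μ ε hμj hεj
    · rw [if_neg h, if_neg h]
      exact hw₂ z j μ ε hμj hεj

include hri hrn hCons in
/-- **The positively symmetrised word `w|_H ∪ θ(w|_H)` of a consistent word is consistent.** -/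
theorem cons_symP (hL : Even L) {w : Site 4 L → α} (hw : Cons w) (i : Fin 4) :
    Cons (fun c => if (c i).val < L / 2 then w c
      else r i (w (Function.update c i (-1 - c i)))) := by
  refine cons_glue hCons hL hw (cons_reflect hri hrn hCons hw i) i ?_ ?_
  · intro z μ ε hz hμ _
    rw [hrn _ _ _ _ hμ, shift_apply_same, neg_one_sub_add_one hL (Or.inl hz), update_shift_self]
  · intro z μ ε hz hμ _
    rw [hrn _ _ _ _ hμ, add_assoc, single_one_add_single_one, add_zero,
      neg_one_sub_eq_add_one hL (Or.inr hz), ← shift_eq_update]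

include hri hrn hCons in
/-- **The negatively symmetrised word `θ(w|_{Hᶜ}) ∪ w|_{Hᶜ}` of a consistent word is
consistent.** -/
theorem cons_symM (hL : Even L) {w : Site 4 L → α} (hw : Cons w) (i : Fin 4) :
    Cons (fun c => if (c i).val < L / 2 then r i (w (Function.update c i (-1 - c i)))
      else w c) := by
  refine cons_glue hCons hL (cons_reflect hri hrn hCons hw i) hw i ?_ ?_
  · intro z μ ε hz hμ _
    rw [hrn _ _ _ _ hμ, add_assoc, single_one_add_single_one, add_zero,
      neg_one_sub_eq_add_one hL (Or.inl hz), ← shift_eq_update]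
  · intro z μ ε hz hμ _
    rw [hrn _ _ _ _ hμ, shift_apply_same, neg_one_sub_add_one hL (Or.inr hz), update_shift_self]

include hri hrn hCons hFld in
/-- **The field of the positively symmetrised word is the positive double `V⁺⁺` of the field**
(item stmt-QuantumFields-10349 in axis `i`): on the closed positive half — `i`-links with
`xᵢ < L/2`, transverse links with `xᵢ ≤ L/2` — the field itself, elsewhere its site reflection
`Θᵢ`; at the boundary plane `xᵢ = L/2` the two readings agree because `Θᵢ` fixes that plane. -/
theorem fld_symP (hL : Even L) {w : Site 4 L → α} (hw : Cons w) (i : Fin 4) :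
    Fld (fun c => if (c i).val < L / 2 then w c else r i (w (Function.update c i (-1 - c i)))) =
      fun e : Edge 4 L => if (if e.2 = i then (e.1 i).val < L / 2 else (e.1 i).val ≤ L / 2) then Fld w e
        else if e.2 = i then (Fld w (Function.update (Site.shift e.1 i) i (-Site.shift e.1 i i), i))⁻¹
          else Fld w (Function.update e.1 i (-e.1 i), e.2) := by
  have hρ := fld_reflect hri hrn hCons hFld hw i
  funext ⟨x, μ⟩
  have h1 : Fld (fun c => if (c i).val < L / 2 then w c
      else r i (w (Function.update c i (-1 - c i)))) (x, μ) =
      if (x i).val < L / 2 then Fld w (x, μ)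
      else Fld (fun c => r i (w (Function.update c i (-1 - c i)))) (x, μ) := by
    simp only [hFld]
    split_ifs <;> rfl
  rw [h1, hρ]
  dsimp only
  by_cases hμ : μ = i
  · subst hμ
    simp only [if_true]
  · simp only [if_neg hμ]
    by_cases hlt : (x i).val < L / 2
    · rw [if_pos hlt, if_pos hlt.le]
    · rw [if_neg hlt]
      by_cases heq : (x i).val = L / 2
      · rw [if_pos heq.le, neg_eq_self_of_val hL heq, Function.update_eq_self]
      · rw [if_neg (by omega)]

include hri hrn hCons hFld in
/-- **The field of the negatively symmetrised word is the negative double `V⁻⁻` of the field**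
(item stmt-QuantumFields-10349 in axis `i`). -/
theorem fld_symM (hL : Even L) {w : Site 4 L → α} (hw : Cons w) (i : Fin 4) :
    Fld (fun c => if (c i).val < L / 2 then r i (w (Function.update c i (-1 - c i))) else w c) =
      fun e : Edge 4 L => if (if e.2 = i then (e.1 i).val < L / 2 else (e.1 i).val ≤ L / 2) then
          (if e.2 = i then (Fld w (Function.update (Site.shift e.1 i) i (-Site.shift e.1 i i), i))⁻¹
          else Fld w (Function.update e.1 i (-e.1 i), e.2))
        else Fld w e := by
  have hρ := fld_reflect hri hrn hCons hFld hw i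
  funext ⟨x, μ⟩
  have h1 : Fld (fun c => if (c i).val < L / 2 then r i (w (Function.update c i (-1 - c i)))
      else w c) (x, μ) =
      if (x i).val < L / 2 then Fld (fun c => r i (w (Function.update c i (-1 - c i)))) (x, μ)
      else Fld w (x, μ) := by
    simp only [hFld]
    split_ifs <;> rfl
  rw [h1, hρ]
  dsimp only
  by_cases hμ : μ = i
  · subst hμ
    simp only [if_true]
  · simp only [if_neg hμ]
    by_cases hlt : (x i).val < L / 2
    · rw [if_pos hlt, if_pos hlt.le]
    · rw [if_neg hlt]
      by_cases heq : (x i).val = L / 2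
      · rw [if_pos heq.le, neg_eq_self_of_val hL heq, Function.update_eq_self]
      · rw [if_neg (by omega)]

/-- The positive symmetrisation is idempotent. -/
theorem symP_idem (hL : Even L) (i : Fin 4) (w : Site 4 L → α) :
    (fun c => if (c i).val < L / 2 then
        (fun c => if (c i).val < L / 2 then w c else r i (w (Function.update c i (-1 - c i)))) c
      else r i ((fun c => if (c i).val < L / 2 then w c
        else r i (w (Function.update c i (-1 - c i)))) (Function.update c i (-1 - c i)))) =
      fun c => if (c i).val < L / 2 then w c else r i (w (Function.update c i (-1 - c i))) := by
  funext c
  dsimp only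
  rw [Function.update_self]
  by_cases h : (c i).val < L / 2
  · rw [if_pos h]
  · rw [if_neg h, if_neg h, if_pos ((val_refl_lt_half_iff hL _).2 h)]

/-- The negative symmetrisation is idempotent. -/
theorem symM_idem (hL : Even L) (i : Fin 4) (w : Site 4 L → α) :
    (fun c => if (c i).val < L / 2 then
        r i ((fun c => if (c i).val < L / 2 then r i (w (Function.update c i (-1 - c i)))
          else w c) (Function.update c i (-1 - c i)))
      else (fun c => if (c i).val < L / 2 then r i (w (Function.update c i (-1 - c i)))
        else w c) c) =
      fun c => if (c i).val < L / 2 then r i (w (Function.update c i (-1 - c i))) else w c := by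
  funext c
  dsimp only
  rw [Function.update_self]
  by_cases h : (c i).val < L / 2
  · rw [if_pos h, if_pos h, if_neg (fun h' => (val_refl_lt_half_iff hL _).1 h' h)]
  · rw [if_neg h]

omit [NeZero L] [Group G] in
include hCons in
/-- Consistency is translation invariant. -/
theorem cons_translate_iff (w : Site 4 L → α) (v : Site 4 L) :
    Cons (fun c => w (c + v)) ↔ Cons w := by
  rw [hCons, hCons]
  have hs : ∀ (z : Site 4 L) j, Site.shift (z + v) j = Site.shift z j + v := fun z j =>
    add_right_comm _ _ _
  constructor
  · intro h z j μ ε hμ hε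
    have h' := h (z - v) j μ ε hμ hε
    rwa [← hs, sub_add_cancel] at h'
  · intro h z j μ ε hμ hε
    rw [← hs]
    exact h (z + v) j μ ε hμ hε

omit [NeZero L] [Group G] in
include hFld in
/-- The field of a translated word is the translated field. -/
theorem fld_translate (w : Site 4 L → α) (v : Site 4 L) :
    Fld (fun c => w (c + v)) = fun e : Edge 4 L => Fld w (e.1 + v, e.2) := by
  funext e
  simp only [hFld]

end Words

end Summit.QuantumFields.QCD.Cruxes.CriticalLineDiamagnetism.ChessboardCellGain

end
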